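import Summits.ResolutionOfSingularities.ResolutionOfSingularities.Theorems.UniversalCellsCampaignW82PerfectionDescentMv
import Summits.ResolutionOfSingularities.ResolutionOfSingularities.Theorems.UniversalCellsCampaignW82PinnedTower
import Mathlib.RingTheory.AlgebraicIndependent.AlgebraicClosure
import Mathlib.RingTheory.AlgebraicIndependent.Transcendental
import Mathlib.FieldTheory.IsPerfectClosure
import HarnessLib

/-!
# [OURS · L1 W8.2] ONE FIELD SUFFICES FOR DOOR 1: resolution over `𝔽_p` and over the single countable perfect
# field `Ω₁(p) = (𝔽_p(x₀, x₁, …))^{perf}` gives resolution over every perfect field of characteristic `p`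

Cell `res-hironaka` (run/shared/lean/pub/res-hironaka/), LADDER-RESOLUTION rung L (RESCUE), slot W8.2; host route
`UniversalCells`, host item `PrimeFieldToPerfect` (stmt-ResolutionOfSingularities-15233), door 1. Proofs file
(Theses-free), written by res-L1-s82-pv-1 (gen 4). The door-1 companion of res-L1-s82-pv-2's door-2 normal form
`PrimeModelTransfer.primeModelTransfer_iff_oneField` (door 2 = `Res(𝔽̄_p) ⇒ Res((𝔽_p(x₀,x₁,…))^{alg})`).

* **`integralRes_rationalTower_of_oneField`** — for a perfect field `Ω` purely inseparable over
  `Frac 𝔽_p[x_n : n ∈ ℕ]` (so `Ω ≅ (𝔽_p(x₀,x₁,…))^{perf}`), resolution of all integral separated schemes of finite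
  type over `Ω` implies the same over every field of the rational tower (every perfect `M` purely inseparable over
  `Frac 𝔽_p[t_i : i ∈ ι]`, `ι` finite non-empty). PROOF: embed `M ↪ Ω` over an injection `ι ↪ ℕ`
  (`PerfectRing.lift` along the `p`-radical `Frac 𝔽_p[t_ι] → M`); over `M`, `Ω` is perfect and purely inseparable
  over `Frac M[x_n : n ∉ ι]` — the remaining variables stay algebraically independent over `M`
  (`AlgebraicIndependent.adjoin_of_disjoint` + `AlgebraicIndependent.extendScalars`, `M` being algebraic over
  `𝔽_p[x_i : i ∈ ι]`) — so the many-variables inverse perfection step `integralRes_of_isPurelyInseparable_mv`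
  (`…PerfectionDescentMv.lean`) applies;
* **`perfectRes_of_primeField_of_oneField`** / `reducedRes_…` — hence `Res(ZMod p)` and `Res(Ω)` give resolution
  over EVERY perfect field of characteristic `p` (`…PinnedTower.perfectRes_of_primeField_of_rationalTower`): DOOR 1
  IS ONE IMPLICATION `Res(𝔽_p) ⇒ Res(Ω₁(p))` BETWEEN THE PRIME FIELD AND ONE COUNTABLE PERFECT FIELD (by-name link
  to the crux in the sibling leaf `…OneFieldLinks.lean`).

HONEST FRAMING. OURS theorems about OURS statements (role replaced: §17 ¶2 p.89 l.59–62 of [Hironaka2017], typed AS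
PRINTED as `S17Methodology.U89_3`); NOT statements of the manuscript; nothing attributed to its author; no typed
candidate used. Nothing here is progress on the open residual; it is a normal form of the crux. AI work, weaker
than expert review; no claim beyond the kernel.
-/

noncomputable section

set_option linter.dupNamespace false -- mandated namespace of this single-conjunct summit

open CategoryTheory CategoryTheory.Limits AlgebraicGeometry TopologicalSpace
open Literature.AlgebraicGeometry.Resolution

namespace Summit.ResolutionOfSingularities.ResolutionOfSingularities.Theorems.CampaignW82

/-- **FROM THE ONE FIELD TO THE RATIONAL TOWER.** See the module docstring. [folklore] -/
theorem integralRes_rationalTower_of_oneField (p : ℕ) (hp : p.Prime) (Ω : Type) [Field Ω] [PerfectField Ω]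
    [Algebra (FractionRing (MvPolynomial ℕ (ZMod p))) Ω]
    [IsPurelyInseparable (FractionRing (MvPolynomial ℕ (ZMod p))) Ω]
    (hΩ : ∀ (X : Scheme.{0}) (f : X ⟶ Spec (.of Ω)), IsSeparated f → LocallyOfFiniteType f →
      QuasiCompact f → IsIntegral X → Scheme.HasResolution X)
    (ι : Type) [Finite ι] [Nonempty ι] (M : Type) [Field M] [PerfectField M]
    [Algebra (FractionRing (MvPolynomial ι (ZMod p))) M]
    [IsPurelyInseparable (FractionRing (MvPolynomial ι (ZMod p))) M]
    (X : Scheme.{0}) (f : X ⟶ Spec (.of M)) (hs : IsSeparated f) (hl : LocallyOfFiniteType f)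
    (hq : QuasiCompact f) (hX : IsIntegral X) : Scheme.HasResolution X := by
  classical
  haveI : Fact p.Prime := ⟨hp⟩
  -- ### notation and characteristic bookkeeping
  let Rι := MvPolynomial ι (ZMod p)
  let Fι := FractionRing Rι
  let RN := MvPolynomial ℕ (ZMod p)
  let FN := FractionRing RN
  haveI : CharP Fι p := charP_of_injective_algebraMap (IsFractionRing.injective Rι Fι) p
  haveI : CharP FN p := charP_of_injective_algebraMap (IsFractionRing.injective RN FN) p
  haveI : CharP M p := charP_of_injective_algebraMap (algebraMap Fι M).injective p
  haveI : CharP Ω p := charP_of_injective_algebraMap (algebraMap FN Ω).injective p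
  haveI : ExpChar Fι p := ExpChar.prime hp
  haveI : ExpChar FN p := ExpChar.prime hp
  haveI : ExpChar M p := ExpChar.prime hp
  haveI : ExpChar Ω p := ExpChar.prime hp
  haveI : Infinite Fι := Infinite.of_injective _ (IsFractionRing.injective Rι Fι)
  haveI : Infinite M := Infinite.of_injective _ (algebraMap Fι M).injective
  -- ### an injection `ι ↪ ℕ` and the induced `Fι → FN → Ω`
  obtain ⟨emb, hemb⟩ := Countable.exists_injective_nat ι
  let r₀ : Rι →+* RN := (MvPolynomial.rename emb : Rι →ₐ[ZMod p] RN).toRingHom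
  have hr₀ : Function.Injective r₀ := MvPolynomial.rename_injective emb hemb
  have hjNinj : Function.Injective ((algebraMap RN FN).comp r₀) := (IsFractionRing.injective RN FN).comp hr₀
  let jN : Fι →+* FN := IsFractionRing.lift (g := (algebraMap RN FN).comp r₀) hjNinj
  have hjN : ∀ P : Rι, jN (algebraMap Rι Fι P) = algebraMap RN FN (MvPolynomial.rename emb P) := fun P =>
    IsFractionRing.lift_algebraMap hjNinj P
  let jF : Fι →+* Ω := (algebraMap FN Ω).comp jN
  -- ### the embedding `e : M → Ω` (`M` is `p`-radical over `Fι`, `Ω` is perfect)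
  let e : M →+* Ω := PerfectRing.lift (algebraMap Fι M) jF p
  have he : ∀ z : Fι, e (algebraMap Fι M z) = jF z := fun z => PerfectRing.lift_comp_apply _ _ p z
  letI algM : Algebra M Ω := e.toAlgebra
  -- ### the variables `ω : ℕ → Ω`; `ω ∘ emb` comes from `M`
  let ω : ℕ → Ω := fun n => algebraMap FN Ω (algebraMap RN FN (MvPolynomial.X n))
  letI algZ : Algebra (ZMod p) Ω := ZMod.algebra Ω p
  have hcompN : ((MvPolynomial.aeval ω : RN →ₐ[ZMod p] Ω) : RN →+* Ω) =
      (algebraMap FN Ω).comp (algebraMap RN FN) := by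
    apply MvPolynomial.ringHom_ext
    · intro c
      exact congrFun (congrArg DFunLike.coe (Subsingleton.elim
        (((MvPolynomial.aeval ω : RN →ₐ[ZMod p] Ω) : RN →+* Ω).comp MvPolynomial.C)
        (((algebraMap FN Ω).comp (algebraMap RN FN)).comp MvPolynomial.C))) c
    · intro n
      simp [ω]
  have hω : AlgebraicIndependent (ZMod p) ω := by
    rw [algebraicIndependent_iff_injective_aeval]
    have hinj : Function.Injective ((algebraMap FN Ω).comp (algebraMap RN FN)) :=
      (algebraMap FN Ω).injective.comp (IsFractionRing.injective RN FN)
    intro a b hab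
    apply hinj
    have ha := congrFun (congrArg DFunLike.coe hcompN) a
    have hb := congrFun (congrArg DFunLike.coe hcompN) b
    simp only [RingHom.coe_coe] at ha hb
    rw [← ha, ← hb]
    exact hab
  -- the variables indexed by `ι` are in the image of `M`
  let tM : ι → M := fun i => algebraMap Fι M (algebraMap Rι Fι (MvPolynomial.X i))
  have htM : ∀ i, e (tM i) = ω (emb i) := fun i => by
    change e (algebraMap Fι M _) = _
    rw [he]
    change algebraMap FN Ω (jN (algebraMap Rι Fι (MvPolynomial.X i))) = _
    rw [hjN, MvPolynomial.rename_X]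
  -- ### `M` is algebraic over `A₀ = 𝔽_p[ω_i : i ∈ emb(ι)] ⊆ e(M)`
  let S : Set ℕ := Set.range emb
  let A₀ : Subalgebra (ZMod p) Ω := Algebra.adjoin (ZMod p) (ω '' S)
  letI algZM : Algebra (ZMod p) M := ZMod.algebra M p
  have heM : ∀ c : ZMod p, e (algebraMap (ZMod p) M c) = algebraMap (ZMod p) Ω c := fun c =>
    congrFun (congrArg DFunLike.coe (Subsingleton.elim (e.comp (algebraMap (ZMod p) M))
      (algebraMap (ZMod p) Ω))) c
  let eR : Subalgebra (ZMod p) Ω :=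
    { e.range with algebraMap_mem' := fun c => ⟨algebraMap (ZMod p) M c, heM c⟩ }
  have hA₀le : A₀ ≤ eR := by
    refine Algebra.adjoin_le ?_
    rintro _ ⟨_, ⟨i, rfl⟩, rfl⟩
    exact ⟨tM i, htM i⟩
  have herr : Function.Injective e.rangeRestrict := fun a b h => e.injective (congrArg Subtype.val h)
  let eM : M ≃+* e.range := RingEquiv.ofBijective e.rangeRestrict ⟨herr, e.rangeRestrict_surjective⟩
  let θ : A₀ →+* M := eM.symm.toRingHom.comp (Subalgebra.inclusion hA₀le).toRingHom
  have hθ : ∀ a : A₀, e (θ a) = (a : Ω) := fun a => by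
    have h1 : (eM (eM.symm ⟨(a : Ω), hA₀le a.2⟩) : Ω) = a := by rw [eM.apply_symm_apply]
    exact h1
  letI algA : Algebra A₀ M := θ.toAlgebra
  haveI : IsScalarTower A₀ M Ω := IsScalarTower.of_algebraMap_eq fun a => (hθ a).symm
  -- every `m : M` is algebraic over `A₀`: `(e m)^{p^n} = jF z`, `z = a / b` with `jF a, jF b ∈ A₀`
  have hjFR : ∀ P : Rι, jF (algebraMap Rι Fι P) ∈ A₀ := fun P => by
    change algebraMap FN Ω (jN (algebraMap Rι Fι P)) ∈ A₀
    rw [hjN]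
    have h1 : algebraMap FN Ω (algebraMap RN FN (MvPolynomial.rename emb P)) =
        MvPolynomial.aeval ω (MvPolynomial.rename emb P) := by
      have := congrFun (congrArg DFunLike.coe hcompN) (MvPolynomial.rename emb P)
      simpa only [RingHom.coe_coe, RingHom.coe_comp, Function.comp_apply] using this.symm
    rw [h1, MvPolynomial.aeval_rename]
    have h2 : (MvPolynomial.aeval (ω ∘ emb) : Rι →ₐ[ZMod p] Ω).range = A₀ := by
      rw [MvPolynomial.aeval_range, Set.range_comp]
    rw [← h2]
    exact ⟨P, rfl⟩
  let eA : M →ₐ[A₀] Ω := { e with commutes' := fun a => hθ a }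
  haveI : Algebra.IsAlgebraic A₀ M := by
    refine ⟨fun m => ?_⟩
    rw [← isAlgebraic_algHom_iff eA e.injective]
    change IsAlgebraic A₀ (e m)
    obtain ⟨n, z, hz⟩ := IsPurelyInseparable.pow_mem Fι p m
    obtain ⟨⟨a, b⟩, hab⟩ := IsLocalization.surj (nonZeroDivisors Rι) z
    have hab' : z * algebraMap Rι Fι b = algebraMap Rι Fι a := hab
    have hb : jF (algebraMap Rι Fι b) ≠ 0 :=
      (map_ne_zero_iff _ jF.injective).mpr
        ((map_ne_zero_iff _ (IsFractionRing.injective Rι Fι)).mpr (nonZeroDivisors.ne_zero b.2))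
    have hkey : jF (algebraMap Rι Fι b) * (e m) ^ p ^ n = jF (algebraMap Rι Fι a) := by
      have h1 : (e m) ^ p ^ n = jF z := by rw [← map_pow, ← hz, he]
      rw [h1, ← map_mul, mul_comm, hab']
    refine ⟨Polynomial.C ⟨_, hjFR b⟩ * Polynomial.X ^ p ^ n - Polynomial.C ⟨_, hjFR a⟩, ?_, ?_⟩
    · intro h
      have h1 := congrArg (fun P : Polynomial A₀ => P.coeff (p ^ n)) h
      have hpn : p ^ n ≠ 0 := pow_ne_zero n hp.ne_zero
      simp only [Polynomial.coeff_sub, Polynomial.coeff_C_mul, Polynomial.coeff_X_pow_self, mul_one,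
        Polynomial.coeff_C, hpn, if_false, sub_zero, Polynomial.coeff_zero] at h1
      exact hb (congrArg Subtype.val h1)
    · simp only [map_sub, map_mul, map_pow, Polynomial.aeval_C, Polynomial.aeval_X, Subalgebra.algebraMap_def,
        Algebra.algebraMap_self, RingHom.id_apply]
      rw [hkey, sub_self]
  -- ### the remaining variables are algebraically independent over `M`
  let κ : Type := ↥(Sᶜ)
  have hωκ₀ : AlgebraicIndependent A₀ (fun k : κ => ω k) :=
    hω.adjoin_of_disjoint (s := S) (t := Sᶜ) disjoint_compl_right
  have hωκ : AlgebraicIndependent M (fun k : κ => ω k) := hωκ₀.extendScalars M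
  -- ### `Frac(M[x_κ]) → Ω`
  let RM := MvPolynomial κ M
  let FM := FractionRing RM
  have haeM : Function.Injective (MvPolynomial.aeval (fun k : κ => ω k) : RM →ₐ[M] Ω) :=
    algebraicIndependent_iff_injective_aeval.mp hωκ
  let ψ : FM →+* Ω :=
    IsFractionRing.lift (g := ((MvPolynomial.aeval (fun k : κ => ω k) : RM →ₐ[M] Ω) : RM →+* Ω)) haeM
  letI algF : Algebra FM Ω := ψ.toAlgebra
  have hψC : ∀ m : M, ψ (algebraMap RM FM (MvPolynomial.C m)) = e m := fun m => by
    change IsFractionRing.lift haeM _ = _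
    rw [IsFractionRing.lift_algebraMap]
    change MvPolynomial.aeval _ (MvPolynomial.C m) = e m
    rw [MvPolynomial.algHom_C]
    rfl
  have hψX : ∀ k : κ, ψ (algebraMap RM FM (MvPolynomial.X k)) = ω k := fun k => by
    change IsFractionRing.lift haeM _ = _
    rw [IsFractionRing.lift_algebraMap]
    change MvPolynomial.aeval _ (MvPolynomial.X k) = ω k
    exact MvPolynomial.aeval_X _ k
  haveI : IsScalarTower M FM Ω := IsScalarTower.of_algebraMap_eq fun m => by
    change e m = ψ (algebraMap M FM m)
    rw [IsScalarTower.algebraMap_apply M RM FM, MvPolynomial.algebraMap_eq, hψC]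
  -- ### `Ω` is purely inseparable over `Frac(M[x_κ])`: the range of `ψ` contains all `ω n`
  let Tψ : Subalgebra (ZMod p) Ω :=
    { ψ.fieldRange.toSubring with
      algebraMap_mem' := fun c => ⟨algebraMap RM FM (MvPolynomial.C (algebraMap (ZMod p) M c)), by
        rw [hψC, heM]⟩ }
  have hωT : Set.range ω ⊆ Tψ := by
    rintro _ ⟨n, rfl⟩
    by_cases hn : n ∈ S
    · obtain ⟨i, rfl⟩ := hn
      exact ⟨algebraMap RM FM (MvPolynomial.C (tM i)), by rw [hψC, htM]⟩
    · exact ⟨_, hψX ⟨n, hn⟩⟩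
  have hpoly : ∀ a : RN, algebraMap FN Ω (algebraMap RN FN a) ∈ ψ.fieldRange := fun a => by
    have h1 : algebraMap FN Ω (algebraMap RN FN a) = MvPolynomial.aeval ω a := by
      have := congrFun (congrArg DFunLike.coe hcompN) a
      simpa only [RingHom.coe_coe, RingHom.coe_comp, Function.comp_apply] using this.symm
    rw [h1]
    have hr : (MvPolynomial.aeval ω : RN →ₐ[ZMod p] Ω).range ≤ Tψ := by
      rw [MvPolynomial.aeval_range]
      exact Algebra.adjoin_le hωT
    exact hr ⟨a, rfl⟩
  haveI : IsPurelyInseparable FM Ω := by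
    refine (isPurelyInseparable_iff_pow_mem FM p).2 fun w => ?_
    obtain ⟨n, z, hz⟩ := IsPurelyInseparable.pow_mem FN p w
    refine ⟨n, ?_⟩
    rw [← hz]
    obtain ⟨⟨a, b⟩, hab⟩ := IsLocalization.surj (nonZeroDivisors RN) z
    have hb : algebraMap FN Ω (algebraMap RN FN b) ≠ 0 :=
      (map_ne_zero_iff _ (algebraMap FN Ω).injective).mpr
        ((map_ne_zero_iff _ (IsFractionRing.injective RN FN)).mpr (nonZeroDivisors.ne_zero b.2))
    have hzq : algebraMap FN Ω z =
        algebraMap FN Ω (algebraMap RN FN a) / algebraMap FN Ω (algebraMap RN FN b) := by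
      rw [eq_div_iff hb, ← map_mul]
      exact congrArg _ hab
    rw [hzq]
    exact RingHom.mem_range.mpr (RingHom.mem_fieldRange.mp (div_mem (hpoly a) (hpoly b)))
  -- ### the many-variables inverse perfection step
  exact integralRes_of_isPurelyInseparable_mv p M κ Ω hΩ X f hs hl hq hX

/-- **ONE FIELD SUFFICES FOR DOOR 1 (integral schemes).** For a prime `p` and a perfect field `Ω` purely
inseparable over `Frac 𝔽_p[x_n : n ∈ ℕ]` (`Ω ≅ (𝔽_p(x₀,x₁,…))^{perf}`, ONE countable perfect field): resolution of all
integral separated schemes of finite type over `ZMod p` and over `Ω` implies the same over EVERY perfect field of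
characteristic `p`. [folklore] -/
theorem perfectRes_of_primeField_of_oneField (p : ℕ) (hp : p.Prime)
    (h₀ : ∀ (X : Scheme.{0}) (f : X ⟶ Spec (.of (ZMod p))), IsSeparated f → LocallyOfFiniteType f →
      QuasiCompact f → IsIntegral X → Scheme.HasResolution X)
    (Ω : Type) [Field Ω] [PerfectField Ω] [Algebra (FractionRing (MvPolynomial ℕ (ZMod p))) Ω]
    [IsPurelyInseparable (FractionRing (MvPolynomial ℕ (ZMod p))) Ω]
    (hΩ : ∀ (X : Scheme.{0}) (f : X ⟶ Spec (.of Ω)), IsSeparated f → LocallyOfFiniteType f →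
      QuasiCompact f → IsIntegral X → Scheme.HasResolution X)
    (k : Type) [Field k] [CharP k p] [PerfectField k] (X : Scheme.{0}) (f : X ⟶ Spec (.of k))
    (hs : IsSeparated f) (hl : LocallyOfFiniteType f) (hq : QuasiCompact f) (hX : IsIntegral X) :
    Scheme.HasResolution X :=
  perfectRes_of_primeField_of_rationalTower p hp h₀
    (fun ι _ _ M _ _ _ _ Y g hs' hl' hq' hY =>
      integralRes_rationalTower_of_oneField p hp Ω hΩ ι M Y g hs' hl' hq' hY)
    k X f hs hl hq hX

/-- **ONE FIELD SUFFICES FOR DOOR 1 (reduced schemes)** — the conclusion shape of the crux at `p`. [folklore] -/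
theorem reducedRes_of_primeField_of_oneField (p : ℕ) (hp : p.Prime)
    (h₀ : ∀ (X : Scheme.{0}) (f : X ⟶ Spec (.of (ZMod p))), IsSeparated f → LocallyOfFiniteType f →
      QuasiCompact f → IsIntegral X → Scheme.HasResolution X)
    (Ω : Type) [Field Ω] [PerfectField Ω] [Algebra (FractionRing (MvPolynomial ℕ (ZMod p))) Ω]
    [IsPurelyInseparable (FractionRing (MvPolynomial ℕ (ZMod p))) Ω]
    (hΩ : ∀ (X : Scheme.{0}) (f : X ⟶ Spec (.of Ω)), IsSeparated f → LocallyOfFiniteType f →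
      QuasiCompact f → IsIntegral X → Scheme.HasResolution X)
    (k : Type) [Field k] [CharP k p] [PerfectField k] (X : Scheme.{0}) (f : X ⟶ Spec (.of k))
    (hs : IsSeparated f) (hl : LocallyOfFiniteType f) (hq : QuasiCompact f) (hX : IsReduced X) :
    Scheme.HasResolution X :=
  Summit.ResolutionOfSingularities.ResolutionOfSingularities.Theorems.descentReducedToIntegral_proof k
    (fun Y g hs' hl' hq' hY => perfectRes_of_primeField_of_oneField p hp h₀ Ω hΩ k Y g hs' hl' hq' hY)
    X f hs hl hq hX

end Summit.ResolutionOfSingularities.ResolutionOfSingularities.Theorems.CampaignW82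

end
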